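import Summits.QuantumFields.YangMills.Theorems.LuscherReductionDressedRitzPolyakovLiftTransplantAE
import HarnessLib

/-!
# Route `LuscherReduction`, item `DressedRitz` (stmt-QuantumFields-20205), line «polyakovlift» r6, stub S-PSCAL″ — THE MAIN TERM IS EXACT AT ANY VACUUM RADIUS
# BELOW THE WRAPPING THRESHOLD (seat ym-20205-polyakovlift-w1a g1; helper `--supports`)

The tree's `PolyakovLift.shadowObs_mul_ground_ae` (LEAD g2, `…TransplantAE`) pins the vacuum cut-off radius to `2R`.  The F9 assembly needs the vacuum trial state
`Φ̂₀ = (χ_{R₀} f_0) ∘ gnCoord μ` at a radius `R₀` DIFFERENT from the observable's `R` (hazard memo `W1A-HAZARD-CF.md`: `R₀ ≍ 1/Λ` while `R` may be smaller).  Here: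
`(g_i ∘ powLink L)·Φ̂₀ = Ψ_{i+1}` pointwise off the equator and almost everywhere, for every `R₀` with `√2·R ≤ R₀` (so `χ_{R₀} = 1` on the support of `χ_R`) and
`√2·R₀·Λ < π` (so the support of `Φ̂₀` consists of `L`-near-centre configurations — the WRAPPING THRESHOLD; beyond it the identity is false: `powLink L` wraps and the
shadow observable is junk while `Φ̂₀ ≠ 0`).

* ★ `shadowObs_mul_ground_eq_of_radius`, ★ `shadowObs_mul_ground_ae_of_radius`.

HONEST FRAMING: chart bookkeeping (conditional femto rung R2b1); nothing here bears on infinite volume, the continuum limit or the Clay gap.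
References: M. Lüscher, NPB 219 (1983) 233 [cite: Luscher1983, §2–§3].
-/

set_option autoImplicit false

noncomputable section

open MeasureTheory Filter Topology Real
open Literature.MathematicalPhysics.QuantumFieldTheory (GaugeConfig Site gaugeTransform haarProbability)
open Literature.Analysis.OperatorTheory.YMMatrixModel
open scoped BigOperators

namespace Summit.QuantumFields.YangMills.Theorems.FemtoTransferGap.PolyakovLift

open Summit.QuantumFields.YangMills.Theorems.FemtoTransferGap

variable {k : ℕ}

/-- ★ **`(g_i ∘ powLink L)(U) · Φ̂₀(U) = Ψ_{i+1}(U)` off the equator, vacuum cut-off at a general radius `R₀`**: `g_i = transplantObsL L Λ R f i`, `μ = Λ/(2L)`,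
`Φ̂₀ = (χ_{R₀}f_0)∘gnCoord μ`, `Ψ_{i+1} = (χ_R f_{i+1}) ∘ gnCoord μ`; `0 < Λ`, `1 ≤ L`, `0 < R`, `√2·R ≤ R₀`, `√2·R₀·Λ < π`, `f_0 > 0`. [cite: Luscher1983, §2–§3] -/
theorem shadowObs_mul_ground_eq_of_radius {Λ R R₀ : ℝ} (hΛ : 0 < Λ) (hR : 0 < R) (hRR₀ : Real.sqrt 2 * R ≤ R₀) (hR₀Λ : Real.sqrt 2 * R₀ * Λ < π)
    {L : ℕ} (hL : 0 < L) (f : Fin (k + 1) → ZM → ℝ) (hpos : ∀ x, 0 < f 0 x) (i : Fin k) {U : Cfg} (hoff : ∀ e, scalarPart (U e) ≠ 0) :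
    transplantObsL L Λ R f i (powLink L U) * (radialCutoff R₀ (gnCoord (Λ / (2 * L)) U) * f 0 (gnCoord (Λ / (2 * L)) U)) =
      radialCutoff R (gnCoord (Λ / (2 * L)) U) * f i.succ (gnCoord (Λ / (2 * L)) U) := by
  have hL' : (0 : ℝ) < L := Nat.cast_pos.mpr hL
  have hs2 : (1 : ℝ) ≤ Real.sqrt 2 := by
    rw [show (1:ℝ) = Real.sqrt 1 by rw [Real.sqrt_one]]
    exact Real.sqrt_le_sqrt (by norm_num)
  have hRle : R ≤ R₀ := le_trans (by nlinarith [hR, hs2]) hRR₀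
  have hR₀ : 0 < R₀ := lt_of_lt_of_le hR hRle
  set μ : ℝ := Λ / (2 * L) with hμdef
  have hμ : 0 < μ := div_pos hΛ (by positivity)
  set y := gnCoord μ U with hy
  by_cases hfar : 2 * R₀ ^ 2 ≤ ‖y‖ ^ 2
  · -- far from the centre: both cut-offs vanish (`R ≤ √2 R ≤ R₀`)
    have h0 : radialCutoff R₀ y = 0 := radialCutoff_eq_zero hR₀ hfar
    have hR0 : radialCutoff R y = 0 := radialCutoff_eq_zero hR (by nlinarith [hfar, hRle, hR])
    rw [h0, hR0, zero_mul, zero_mul, mul_zero]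
  · -- near the centre: `‖y‖ < √2 R₀`, hence `L μ ‖y‖ < π/2` and the dilation identity applies
    push Not at hfar
    have hnorm : ‖y‖ < Real.sqrt 2 * R₀ := by
      have h0 : 0 ≤ ‖y‖ := norm_nonneg _
      have : ‖y‖ ^ 2 < (Real.sqrt 2 * R₀) ^ 2 := by
        rw [mul_pow, Real.sq_sqrt (by norm_num : (0:ℝ) ≤ 2)]; exact hfar
      exact lt_of_pow_lt_pow_left₀ 2 (by positivity) this
    have hsmall : (L : ℝ) * (μ * ‖y‖) < π / 2 := by
      have h1 : (L : ℝ) * (μ * ‖y‖) ≤ (L : ℝ) * (μ * (Real.sqrt 2 * R₀)) :=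
        mul_le_mul_of_nonneg_left (mul_le_mul_of_nonneg_left hnorm.le hμ.le) hL'.le
      have h2 : (L : ℝ) * (μ * (Real.sqrt 2 * R₀)) = Real.sqrt 2 * R₀ * Λ / 2 := by
        rw [hμdef]; field_simp
      linarith
    have hnc : ∀ j : Fin 3, IsNearCentre L (U (edgeOf j)) := fun j => isNearCentre_of_gnCoord hμ hoff (by rwa [← hy]) j
    rw [transplantObsL_powLink hL hΛ R f i hnc, transplantFn]
    show radialCutoff R y * (f i.succ y / f 0 y) * (radialCutoff R₀ y * f 0 y) = radialCutoff R y * f i.succ y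
    by_cases hRy : radialCutoff R y = 0
    · rw [hRy]; ring
    · have hy2 : ‖y‖ ^ 2 < 2 * R ^ 2 := by
        by_contra hcon; push Not at hcon; exact hRy (radialCutoff_eq_zero hR hcon)
      have hyle : ‖y‖ ≤ R₀ := by
        have h0 : 0 ≤ ‖y‖ := norm_nonneg _
        have h1 : ‖y‖ ^ 2 < (Real.sqrt 2 * R) ^ 2 := by
          rw [mul_pow, Real.sq_sqrt (by norm_num : (0:ℝ) ≤ 2)]; exact hy2
        have h2 : ‖y‖ < Real.sqrt 2 * R := lt_of_pow_lt_pow_left₀ 2 (by positivity) h1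
        linarith
      rw [radialCutoff_eq_one hR₀ hyle]
      field_simp [(hpos y).ne']

/-- ★★ **The main term of the shadow insertion is the LOWER lane's excited quasimode, almost everywhere — vacuum cut-off at any radius `R₀` with
`√2·R ≤ R₀` and `√2·R₀·Λ < π` (below the wrapping threshold).** [cite: Luscher1983, §2–§3] -/
theorem shadowObs_mul_ground_ae_of_radius {Λ R R₀ : ℝ} (hΛ : 0 < Λ) (hR : 0 < R) (hRR₀ : Real.sqrt 2 * R ≤ R₀) (hR₀Λ : Real.sqrt 2 * R₀ * Λ < π)
    {L : ℕ} (hL : 0 < L) (f : Fin (k + 1) → ZM → ℝ) (hpos : ∀ x, 0 < f 0 x) (i : Fin k) :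
    (fun U : Cfg => transplantObsL L Λ R f i (powLink L U) *
        (radialCutoff R₀ (gnCoord (Λ / (2 * L)) U) * f 0 (gnCoord (Λ / (2 * L)) U))) =ᵐ[configMeasure SU2 1]
      fun U => radialCutoff R (gnCoord (Λ / (2 * L)) U) * f i.succ (gnCoord (Λ / (2 * L)) U) := by
  filter_upwards [ae_scalarPart_ne_zero] with U hU
  exact shadowObs_mul_ground_eq_of_radius hΛ hR hRR₀ hR₀Λ hL f hpos i hU

end Summit.QuantumFields.YangMills.Theorems.FemtoTransferGap.PolyakovLift

end
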